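import Literature.Algebra.Polynomial.MarkovLukacs
import Literature.Algebra.Polynomial.NonnegUnivariateTwoSquares
import HarnessLib

/-!
# Goursat's lemma (both halves, strict form) and the two-squares Fekete / Markov–Lukács forms

M. Laurent, *Sums of squares, moment matrices and optimization over polynomials* (2008; updated
version 2010), §3.6.3, p. 40:

* **Lemma 3.22 (Goursat's lemma).** For `f ∈ ℝ[x]` with `deg f ≤ m` and its Goursat transform
  `f̃(x) = (1 + x)ᵐ f((1 − x)/(1 + x))` (the tree's `MarkovLukacs.goursat m f`):
  (i) `f ≥ 0` on `[−1, 1]` **iff** `f̃ ≥ 0` on `[0, ∞)` (`goursat_eval_nonneg_iff`; the tree's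
  `MarkovLukacs.goursat_eval_nonneg` is the forward half only);
  (ii) `f > 0` on `[−1, 1]` **iff** `f̃ > 0` on `[0, ∞)` and `f(−1) > 0` (`goursat_eval_pos_iff`),
  "noting that `deg f̃ ≤ m` and the coefficient of `xᵐ` in `f̃` is equal to `f(−1)`"
  (`coeff_goursat_self`, `natDegree_goursat_eq`), together with the inversion formula
  `2ᵐ f(x) = (1 + x)ᵐ f̃((1 − x)/(1 + x))` (`two_pow_mul_eval`, from the tree's involution identity
  `goursat_goursat`).
* **Theorem 3.23 (Fekete, Markov–Lukács)** in the precision of Laurent's proof, which writes the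
  Pólya–Szegő half-line representation with *two* squares in each sum (Theorem 3.21 / Lemma 3.5;
  the tree's `NonnegUnivariateTwoSquares`): for `p ≥ 0` on `[−1, 1]`,
  (i) `deg p ≤ 2d`:  `p = A² + B² + (1 − x²)(C² + D²)`, `deg A, B ≤ d`, `deg C, D ≤ d − 1`
  (`markovLukacs_even_unit_two_sq`; Fekete's form of Pólya–Szegő VI.46 with two squares,
  `fekete_two_sq`);  `deg p ≤ 2d + 1`: the same shape with `deg A, B ≤ d + 1`, `deg C, D ≤ d`
  (`markovLukacs_odd_unit_two_sq'`, via Laurent's identities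
  `1 + x = (1 + x)²/2 + (1 − x²)/2`, `1 − x = (1 − x)²/2 + (1 − x²)/2`);
  (ii) `deg p ≤ 2d + 1`: `p = (1 + x)(A² + B²) + (1 − x)(C² + D²)`, all of degree `≤ d`
  (`markovLukacs_odd_unit_two_sq`).
  On a general interval `[a, b]`, `a < b`: `p = A² + B² + (x − a)(b − x)(C² + D²)` resp.
  `p = (x − a)(A² + B²) + (b − x)(C² + D²)` with the same degree budgets
  (`markovLukacs_even_two_sq`, `markovLukacs_odd_two_sq`), and without degree bookkeeping the
  descriptions of the cone of polynomials non-negative on `[a, b]`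
  ("`P_K = T(1 − x²) = T(1 − x, 1 + x)`") `forall_eval_nonneg_Icc_iff`,
  `forall_eval_nonneg_Icc_iff'`.

Everything is a corollary of the tree's weak forms (`MarkovLukacs.markovLukacs_even_unit`,
`…_odd_unit`, `markovLukacs_even`, `markovLukacs_odd`: finitely many squares) and of Lemma 3.5
(`NonnegUnivariateTwoSquares.exists_sq_add_sq_eq_natDegree`: a polynomial non-negative on `ℝ` is
`A² + B²` with `2·deg A, 2·deg B ≤ deg`), applied to each finite sum of squares
(`sum_sq_eq_sq_add_sq`). The sharp *single*-square forms of Fekete (Pólya–Szegő VI.46) and Lukács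
(VI.47), which go through the Fejér–Riesz theorem with real coefficients, are NOT here.

## References

* M. Laurent, *Sums of squares, moment matrices and optimization over polynomials*, in: Emerging
  Applications of Algebraic Geometry, IMA Vol. Math. Appl. 149, Springer (2009) 157–270; updated
  version (2010) §3.6.3, Lemma 3.22 and Theorem 3.23 (p. 40), Lemma 3.5 (p. 30).
  [cite: Laurent2008, Lemma 3.22 and Theorem 3.23]
* V. Powers, B. Reznick, *Polynomials that are positive on an interval*, Trans. AMS 352 (2000)
  4677–4692, §2 Lemma 1 (Goursat's lemma) and eq. (4). [cite: PowersReznick2000, §2 Lemma 1]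
* G. Pólya, G. Szegő, *Problems and Theorems in Analysis II*, Springer (1976), Part VI §6,
  Problems 46 (Fekete) and 47 (Lukács). [cite: PolyaSzego1976, Part VI Problems 46-47]
-/

noncomputable section

open Polynomial Finset Filter
open scoped BigOperators Topology

namespace Literature.Algebra.Polynomial.MarkovLukacsTwoSquares

open Literature.Algebra.Polynomial.MarkovLukacs
open Literature.Algebra.Polynomial.NonnegUnivariateTwoSquares

/-! ## Goursat's lemma (Laurent 2008, Lemma 3.22) -/

/-- `deg (1 − X) ≤ 1`. [folklore] -/
private theorem natDegree_one_sub_X_le : (1 - X : ℝ[X]).natDegree ≤ 1 :=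
  (natDegree_sub_le _ _).trans (by simp)

/-- `deg (1 + X) ≤ 1`. [folklore] -/
private theorem natDegree_one_add_X_le : (1 + X : ℝ[X]).natDegree ≤ 1 :=
  (natDegree_add_le _ _).trans (by simp)

/-- The coefficient of `Xᵐ` in `(1 − X)ᵏ (1 + X)^(m − k)` is `(−1)ᵏ` (`k ≤ m`). [folklore] -/
private theorem coeff_one_sub_X_pow_mul (m k : ℕ) (hk : k ≤ m) :
    ((1 - X : ℝ[X]) ^ k * (1 + X) ^ (m - k)).coeff m = (-1) ^ k := by
  have h1 : ((1 - X : ℝ[X]) ^ k).coeff k = (-1) ^ k := by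
    have h := coeff_pow_of_natDegree_le (m := k) natDegree_one_sub_X_le
    rw [mul_one] at h
    rw [h, coeff_sub, coeff_one, coeff_X_one, if_neg one_ne_zero, zero_sub]
  have h2 : ((1 + X : ℝ[X]) ^ (m - k)).coeff (m - k) = 1 := by
    have h := coeff_pow_of_natDegree_le (m := m - k) natDegree_one_add_X_le
    rw [mul_one] at h
    rw [h, coeff_add, coeff_one, coeff_X_one, if_neg one_ne_zero, zero_add, one_pow]
  have h := coeff_mul_add_eq_of_natDegree_le
    (natDegree_pow_le_of_le k natDegree_one_sub_X_le)
    (natDegree_pow_le_of_le (m - k) natDegree_one_add_X_le)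
  rw [mul_one, mul_one, Nat.add_sub_of_le hk, h1, h2, mul_one] at h
  exact h

/-- **The top coefficient of the Goursat transform**: for `deg f ≤ m` the coefficient of `Xᵐ` in
`goursat m f` is `f(−1)` (Laurent 2008, proof of Lemma 3.22). [cite: Laurent2008, Lemma 3.22] -/
theorem coeff_goursat_self {m : ℕ} {f : ℝ[X]} (hf : f.natDegree ≤ m) :
    (goursat m f).coeff m = f.eval (-1) := by
  rw [eval_eq_sum_range' (Nat.lt_succ_of_le hf), goursat, finsetSum_coeff]
  refine Finset.sum_congr rfl fun k hk => ?_
  have hk' : k ≤ m := Nat.lt_succ_iff.mp (Finset.mem_range.mp hk)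
  rw [mul_assoc, coeff_C_mul, coeff_one_sub_X_pow_mul m k hk']

/-- If `deg f ≤ m` and `f(−1) ≠ 0` then `deg (goursat m f) = m` (Laurent 2008, Lemma 3.22 (ii):
"i.e., `deg f̃ = m`"). [cite: Laurent2008, Lemma 3.22] -/
theorem natDegree_goursat_eq {m : ℕ} {f : ℝ[X]} (hf : f.natDegree ≤ m) (h : f.eval (-1) ≠ 0) :
    (goursat m f).natDegree = m :=
  le_antisymm (natDegree_goursat_le m f) (le_natDegree_of_ne_zero (by rwa [coeff_goursat_self hf]))

/-- **Inversion of the Goursat transform, pointwise**: for `deg f ≤ m` and `1 + x ≠ 0`,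
`2ᵐ f(x) = (1 + x)ᵐ f̃((1 − x)/(1 + x))` (Laurent 2008, p. 40: `f̃̃ = 2ᵐ f`; Powers–Reznick 2000
eq. (4)). [cite: Laurent2008, Lemma 3.22] -/
theorem two_pow_mul_eval {m : ℕ} {f : ℝ[X]} (hf : f.natDegree ≤ m) {x : ℝ} (hx : 1 + x ≠ 0) :
    (2 : ℝ) ^ m * f.eval x = (1 + x) ^ m * (goursat m f).eval ((1 - x) / (1 + x)) := by
  have h := congrArg (eval x) (goursat_goursat hf)
  rw [eval_mul, eval_C, eval_goursat (natDegree_goursat_le m f) hx] at h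
  exact h.symm

/-- A polynomial of degree `≤ m` which is non-negative on `[0, ∞)` has a non-negative coefficient of
`Xᵐ` (it is `0` or the leading coefficient). [folklore] -/
private theorem coeff_nonneg_of_eval_nonneg {g : ℝ[X]} {m : ℕ} (hg : g.natDegree ≤ m)
    (hpos : ∀ y : ℝ, 0 ≤ y → 0 ≤ g.eval y) : 0 ≤ g.coeff m := by
  rcases hg.lt_or_eq with hlt | heq
  · rw [coeff_eq_zero_of_natDegree_lt hlt]
  rw [← heq, coeff_natDegree]
  by_contra hneg
  rw [not_le] at hneg
  rcases Nat.eq_zero_or_pos g.natDegree with h0 | hdeg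
  · have h := hpos 0 le_rfl
    rw [eq_C_of_natDegree_eq_zero h0, eval_C] at h
    rw [leadingCoeff, h0] at hneg
    exact absurd h (not_le.mpr hneg)
  · have ht := g.tendsto_atBot_of_leadingCoeff_nonpos (natDegree_pos_iff_degree_pos.mp hdeg) hneg.le
    obtain ⟨y, hy, hy0⟩ :=
      ((ht.eventually (eventually_lt_atBot 0)).and (eventually_ge_atTop 0)).exists
    exact absurd (hpos y hy0) (not_le.mpr hy)

/-- For `−1 < x ≤ 1` the point `(1 − x)/(1 + x)` lies in `[0, ∞)`. [folklore] -/
private theorem div_nonneg_of_mem {x : ℝ} (h1 : -1 < x) (h2 : x ≤ 1) : 0 ≤ (1 - x) / (1 + x) :=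
  div_nonneg (by linarith) (by linarith)

/-- **Goursat's lemma, (i)** (Laurent 2008, Lemma 3.22 (i); Powers–Reznick 2000, Lemma 1): for
`deg f ≤ m`, `f ≥ 0` on `[−1, 1]` iff `goursat m f ≥ 0` on `[0, ∞)`.
[cite: Laurent2008, Lemma 3.22] -/
theorem goursat_eval_nonneg_iff {m : ℕ} {f : ℝ[X]} (hf : f.natDegree ≤ m) :
    (∀ x ∈ Set.Icc (-1 : ℝ) 1, 0 ≤ f.eval x) ↔ ∀ y : ℝ, 0 ≤ y → 0 ≤ (goursat m f).eval y := by
  refine ⟨fun h y hy => goursat_eval_nonneg hf h hy, fun h x hx => ?_⟩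
  rcases eq_or_lt_of_le hx.1 with hx1 | hx1
  · rw [← hx1, ← coeff_goursat_self hf]
    exact coeff_nonneg_of_eval_nonneg (natDegree_goursat_le m f) h
  · have h1 : (0 : ℝ) < 1 + x := by linarith
    have key := two_pow_mul_eval hf h1.ne'
    have h2 : 0 ≤ (1 + x) ^ m * (goursat m f).eval ((1 - x) / (1 + x)) :=
      mul_nonneg (pow_nonneg h1.le m) (h _ (div_nonneg_of_mem hx1 hx.2))
    rw [← key] at h2
    by_contra hneg
    have h3 : (2 : ℝ) ^ m * f.eval x < 0 :=
      mul_neg_of_pos_of_neg (pow_pos two_pos m) (not_le.mp hneg)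
    exact absurd h2 (not_le.mpr h3)

/-- **Goursat's lemma, (ii)** (Laurent 2008, Lemma 3.22 (ii)): for `deg f ≤ m`, `f > 0` on `[−1, 1]`
iff `goursat m f > 0` on `[0, ∞)` and `f(−1) > 0` (the latter says `deg (goursat m f) = m`,
`natDegree_goursat_eq`). [cite: Laurent2008, Lemma 3.22] -/
theorem goursat_eval_pos_iff {m : ℕ} {f : ℝ[X]} (hf : f.natDegree ≤ m) :
    (∀ x ∈ Set.Icc (-1 : ℝ) 1, 0 < f.eval x) ↔
      (∀ y : ℝ, 0 ≤ y → 0 < (goursat m f).eval y) ∧ 0 < f.eval (-1) := by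
  constructor
  · intro h
    refine ⟨fun y hy => ?_, h (-1) ⟨le_rfl, by norm_num⟩⟩
    have hy1 : (0 : ℝ) < 1 + y := by linarith
    rw [eval_goursat hf hy1.ne']
    refine mul_pos (pow_pos hy1 m) (h _ ⟨?_, ?_⟩)
    · rw [le_div_iff₀ hy1]; linarith
    · rw [div_le_one hy1]; linarith
  · rintro ⟨h, hm1⟩ x hx
    rcases eq_or_lt_of_le hx.1 with hx1 | hx1
    · rwa [← hx1]
    · have h1 : (0 : ℝ) < 1 + x := by linarith
      have key := two_pow_mul_eval hf h1.ne'
      have h2 : 0 < (1 + x) ^ m * (goursat m f).eval ((1 - x) / (1 + x)) :=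
        mul_pos (pow_pos h1 m) (h _ (div_nonneg_of_mem hx1 hx.2))
      rw [← key] at h2
      by_contra hneg
      have h3 : (2 : ℝ) ^ m * f.eval x ≤ 0 :=
        mul_nonpos_of_nonneg_of_nonpos (pow_nonneg zero_le_two m) (not_lt.mp hneg)
      exact absurd h2 (not_lt.mpr h3)

/-! ## Finite sums of squares are sums of two squares (Laurent 2008, Lemma 3.5) -/

/-- A finite sum of squares of real polynomials of degree `≤ d` is `A² + B²` with `deg A, deg B ≤ d`
(Laurent 2008, Lemma 3.5, with the degree count `deg (A² + B²) = 2·max (deg A, deg B)`).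
[cite: Laurent2008, Lemma 3.5] -/
theorem sum_sq_eq_sq_add_sq (m : ℕ) (f : ℕ → ℝ[X]) {d : ℕ} (hf : ∀ i < m, (f i).natDegree ≤ d) :
    ∃ A B : ℝ[X], A.natDegree ≤ d ∧ B.natDegree ≤ d ∧
      A ^ 2 + B ^ 2 = ∑ i ∈ Finset.range m, f i ^ 2 := by
  have hnn : ∀ x : ℝ, 0 ≤ (∑ i ∈ Finset.range m, f i ^ 2).eval x := fun x => by
    rw [eval_finsetSum]
    exact Finset.sum_nonneg fun i _ => by rw [eval_pow]; exact sq_nonneg _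
  have hdeg : (∑ i ∈ Finset.range m, f i ^ 2).natDegree ≤ 2 * d :=
    natDegree_sum_le_of_forall_le _ _ fun i hi =>
      natDegree_pow_le_of_le 2 (hf i (Finset.mem_range.mp hi))
  obtain ⟨A, B, hAB, hA, hB⟩ := exists_sq_add_sq_eq_natDegree _ hnn
  exact ⟨A, B, by omega, by omega, hAB⟩

/-! ## Two-squares forms on `[−1, 1]` (Laurent 2008, Theorem 3.23) -/

/-- **Theorem 3.23 (i), even degree, two squares**: if `deg p ≤ 2d` and `p ≥ 0` on `[−1, 1]` then
`p = A² + B² + (1 − X²)(C² + D²)` with `deg A, B ≤ d`, `deg C, D ≤ d − 1`.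
[cite: Laurent2008, Theorem 3.23 (i)] -/
theorem markovLukacs_even_unit_two_sq (d : ℕ) (p : ℝ[X]) (hdeg : p.natDegree ≤ 2 * d)
    (hpos : ∀ x ∈ Set.Icc (-1 : ℝ) 1, 0 ≤ p.eval x) :
    ∃ A B C' D : ℝ[X], (A.natDegree ≤ d ∧ B.natDegree ≤ d ∧ C'.natDegree ≤ d - 1 ∧
      D.natDegree ≤ d - 1) ∧ p = A ^ 2 + B ^ 2 + (1 - X ^ 2) * (C' ^ 2 + D ^ 2) := by
  obtain ⟨m, f, g, hfg, hp⟩ := markovLukacs_even_unit d p hdeg hpos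
  obtain ⟨A, B, hA, hB, hAB⟩ := sum_sq_eq_sq_add_sq m f fun i hi => (hfg i hi).1
  obtain ⟨C', D, hC, hD, hCD⟩ := sum_sq_eq_sq_add_sq m g fun i hi => (hfg i hi).2
  exact ⟨A, B, C', D, ⟨hA, hB, hC, hD⟩, by rw [hp, ← hAB, ← hCD]⟩

/-- **Fekete's theorem (Pólya–Szegő VI.46) with two squares**: a polynomial of degree `≤ n` which is
non-negative on `[−1, 1]` is `A² + B² + (1 − X²)(C² + D²)` with `deg A, B ≤ n`, `deg C, D ≤ n − 1`
(Pólya–Szegő: one square each). [cite: Laurent2008, Theorem 3.23 (i)] -/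
theorem fekete_two_sq (n : ℕ) (p : ℝ[X]) (hdeg : p.natDegree ≤ n)
    (hpos : ∀ x ∈ Set.Icc (-1 : ℝ) 1, 0 ≤ p.eval x) :
    ∃ A B C' D : ℝ[X], (A.natDegree ≤ n ∧ B.natDegree ≤ n ∧ C'.natDegree ≤ n - 1 ∧
      D.natDegree ≤ n - 1) ∧ p = A ^ 2 + B ^ 2 + (1 - X ^ 2) * (C' ^ 2 + D ^ 2) :=
  markovLukacs_even_unit_two_sq n p (hdeg.trans (by omega)) hpos

/-- **Theorem 3.23 (ii), odd degree, two squares**: if `deg p ≤ 2d + 1` and `p ≥ 0` on `[−1, 1]`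
then `p = (1 + X)(A² + B²) + (1 − X)(C² + D²)` with `deg A, B, C, D ≤ d`.
[cite: Laurent2008, Theorem 3.23 (ii)] -/
theorem markovLukacs_odd_unit_two_sq (d : ℕ) (p : ℝ[X]) (hdeg : p.natDegree ≤ 2 * d + 1)
    (hpos : ∀ x ∈ Set.Icc (-1 : ℝ) 1, 0 ≤ p.eval x) :
    ∃ A B C' D : ℝ[X], (A.natDegree ≤ d ∧ B.natDegree ≤ d ∧ C'.natDegree ≤ d ∧
      D.natDegree ≤ d) ∧ p = (1 + X) * (A ^ 2 + B ^ 2) + (1 - X) * (C' ^ 2 + D ^ 2) := by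
  obtain ⟨m, f, g, hfg, hp⟩ := markovLukacs_odd_unit d p hdeg hpos
  obtain ⟨A, B, hA, hB, hAB⟩ := sum_sq_eq_sq_add_sq m f fun i hi => (hfg i hi).1
  obtain ⟨C', D, hC, hD, hCD⟩ := sum_sq_eq_sq_add_sq m g fun i hi => (hfg i hi).2
  exact ⟨A, B, C', D, ⟨hA, hB, hC, hD⟩, by rw [hp, ← hAB, ← hCD]⟩

/-- `deg (A² + B²) ≤ 2d` when `deg A, deg B ≤ d`. [folklore] -/
private theorem natDegree_sq_add_sq_le {A B : ℝ[X]} {d : ℕ} (hA : A.natDegree ≤ d)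
    (hB : B.natDegree ≤ d) : (A ^ 2 + B ^ 2).natDegree ≤ 2 * d :=
  natDegree_add_le_of_degree_le (natDegree_pow_le_of_le 2 hA) (natDegree_pow_le_of_le 2 hB)

/-- **Theorem 3.23 (i), odd degree, two squares**: if `deg p ≤ 2d + 1` and `p ≥ 0` on `[−1, 1]`
then `p = A² + B² + (1 − X²)(C² + D²)` with `deg A, B ≤ d + 1` and `deg C, D ≤ d` (summands of
degree `≤ deg p + 1`; from (ii) by `1 + x = (1 + x)²/2 + (1 − x²)/2`,
`1 − x = (1 − x)²/2 + (1 − x²)/2`). [cite: Laurent2008, Theorem 3.23 (i)] -/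
theorem markovLukacs_odd_unit_two_sq' (d : ℕ) (p : ℝ[X]) (hdeg : p.natDegree ≤ 2 * d + 1)
    (hpos : ∀ x ∈ Set.Icc (-1 : ℝ) 1, 0 ≤ p.eval x) :
    ∃ A B C' D : ℝ[X], (A.natDegree ≤ d + 1 ∧ B.natDegree ≤ d + 1 ∧ C'.natDegree ≤ d ∧
      D.natDegree ≤ d) ∧ p = A ^ 2 + B ^ 2 + (1 - X ^ 2) * (C' ^ 2 + D ^ 2) := by
  obtain ⟨A₁, B₁, C₁, D₁, ⟨hA, hB, hC, hD⟩, hp⟩ := markovLukacs_odd_unit_two_sq d p hdeg hpos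
  -- `s = ((1 + X)² (A₁² + B₁²) + (1 − X)² (C₁² + D₁²))/2`, `t = (A₁² + B₁² + C₁² + D₁²)/2`
  set s : ℝ[X] := C (1 / 2 : ℝ) * ((1 + X) ^ 2 * (A₁ ^ 2 + B₁ ^ 2) +
    (1 - X) ^ 2 * (C₁ ^ 2 + D₁ ^ 2)) with hs_def
  set t : ℝ[X] := C (1 / 2 : ℝ) * ((A₁ ^ 2 + B₁ ^ 2) + (C₁ ^ 2 + D₁ ^ 2)) with ht_def
  have hpst : p = s + (1 - X ^ 2) * t := by
    apply Polynomial.funext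
    intro x
    rw [hp]
    simp only [hs_def, ht_def, eval_add, eval_mul, eval_pow, eval_C, eval_sub, eval_one, eval_X]
    ring
  have hs : ∀ x : ℝ, 0 ≤ s.eval x := fun x => by
    simp only [hs_def, eval_add, eval_mul, eval_pow, eval_C, eval_sub, eval_one, eval_X]
    positivity
  have ht : ∀ x : ℝ, 0 ≤ t.eval x := fun x => by
    simp only [ht_def, eval_add, eval_mul, eval_pow, eval_C]
    positivity
  have hsdeg : s.natDegree ≤ 2 * (d + 1) := by
    refine (natDegree_C_mul_le _ _).trans (natDegree_add_le_of_degree_le ?_ ?_)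
    · exact (natDegree_mul_le_of_le (natDegree_pow_le_of_le 2 natDegree_one_add_X_le)
        (natDegree_sq_add_sq_le hA hB)).trans (by omega)
    · exact (natDegree_mul_le_of_le (natDegree_pow_le_of_le 2 natDegree_one_sub_X_le)
        (natDegree_sq_add_sq_le hC hD)).trans (by omega)
  have htdeg : t.natDegree ≤ 2 * d :=
    (natDegree_C_mul_le _ _).trans
      (natDegree_add_le_of_degree_le (natDegree_sq_add_sq_le hA hB) (natDegree_sq_add_sq_le hC hD))
  obtain ⟨A, B, hAB, hA', hB'⟩ := exists_sq_add_sq_eq_natDegree s hs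
  obtain ⟨C', D, hCD, hC', hD'⟩ := exists_sq_add_sq_eq_natDegree t ht
  exact ⟨A, B, C', D, ⟨by omega, by omega, by omega, by omega⟩, by rw [hpst, hAB, hCD]⟩

/-! ## Two-squares forms on `[a, b]` -/

/-- **Markov–Lukács on `[a, b]`, even degree, two squares**: `a < b`, `deg p ≤ 2d`, `p ≥ 0` on
`[a, b]` ⟹ `p = A² + B² + (X − a)(b − X)(C² + D²)`, `deg A, B ≤ d`, `deg C, D ≤ d − 1`.
[cite: Laurent2008, Theorem 3.23 (i)] -/
theorem markovLukacs_even_two_sq {a b : ℝ} (hab : a < b) (d : ℕ) (p : ℝ[X])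
    (hdeg : p.natDegree ≤ 2 * d) (hpos : ∀ x ∈ Set.Icc a b, 0 ≤ p.eval x) :
    ∃ A B C' D : ℝ[X], (A.natDegree ≤ d ∧ B.natDegree ≤ d ∧ C'.natDegree ≤ d - 1 ∧
      D.natDegree ≤ d - 1) ∧ p = A ^ 2 + B ^ 2 + (X - C a) * (C b - X) * (C' ^ 2 + D ^ 2) := by
  obtain ⟨m, f, g, hfg, hp⟩ := markovLukacs_even hab d p hdeg hpos
  obtain ⟨A, B, hA, hB, hAB⟩ := sum_sq_eq_sq_add_sq m f fun i hi => (hfg i hi).1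
  obtain ⟨C', D, hC, hD, hCD⟩ := sum_sq_eq_sq_add_sq m g fun i hi => (hfg i hi).2
  exact ⟨A, B, C', D, ⟨hA, hB, hC, hD⟩, by rw [hp, ← hAB, ← hCD]⟩

/-- **Markov–Lukács on `[a, b]`, odd degree, two squares**: `a < b`, `deg p ≤ 2d + 1`, `p ≥ 0` on
`[a, b]` ⟹ `p = (X − a)(A² + B²) + (b − X)(C² + D²)`, `deg A, B, C, D ≤ d`.
[cite: Laurent2008, Theorem 3.23 (ii)] -/
theorem markovLukacs_odd_two_sq {a b : ℝ} (hab : a < b) (d : ℕ) (p : ℝ[X])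
    (hdeg : p.natDegree ≤ 2 * d + 1) (hpos : ∀ x ∈ Set.Icc a b, 0 ≤ p.eval x) :
    ∃ A B C' D : ℝ[X], (A.natDegree ≤ d ∧ B.natDegree ≤ d ∧ C'.natDegree ≤ d ∧
      D.natDegree ≤ d) ∧ p = (X - C a) * (A ^ 2 + B ^ 2) + (C b - X) * (C' ^ 2 + D ^ 2) := by
  obtain ⟨m, f, g, hfg, hp⟩ := markovLukacs_odd hab d p hdeg hpos
  obtain ⟨A, B, hA, hB, hAB⟩ := sum_sq_eq_sq_add_sq m f fun i hi => (hfg i hi).1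
  obtain ⟨C', D, hC, hD, hCD⟩ := sum_sq_eq_sq_add_sq m g fun i hi => (hfg i hi).2
  exact ⟨A, B, C', D, ⟨hA, hB, hC, hD⟩, by rw [hp, ← hAB, ← hCD]⟩

/-- **The cone of polynomials non-negative on `[a, b]` is `T((x − a)(b − x))`, with two squares**:
for `a < b`, `p ≥ 0` on `[a, b]` iff `p = A² + B² + (X − a)(b − X)(C² + D²)` for some real
polynomials `A, B, C, D` (Laurent 2008, Theorem 3.23: `P_K = T(1 − x²)`).
[cite: Laurent2008, Theorem 3.23] -/
theorem forall_eval_nonneg_Icc_iff {a b : ℝ} (hab : a < b) (p : ℝ[X]) :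
    (∀ x ∈ Set.Icc a b, 0 ≤ p.eval x) ↔
      ∃ A B C' D : ℝ[X], p = A ^ 2 + B ^ 2 + (X - C a) * (C b - X) * (C' ^ 2 + D ^ 2) := by
  constructor
  · intro h
    obtain ⟨A, B, C', D, -, hp⟩ :=
      markovLukacs_even_two_sq hab p.natDegree p (by omega) h
    exact ⟨A, B, C', D, hp⟩
  · rintro ⟨A, B, C', D, hp⟩ x hx
    rw [hp]
    simp only [eval_add, eval_mul, eval_pow, eval_sub, eval_X, eval_C]
    have h1 : 0 ≤ (x - a) * (b - x) := mul_nonneg (by linarith [hx.1]) (by linarith [hx.2])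
    positivity

/-- **The cone of polynomials non-negative on `[a, b]` is `T(x − a, b − x)`, with two squares**:
for `a < b`, `p ≥ 0` on `[a, b]` iff `p = (X − a)(A² + B²) + (b − X)(C² + D²)` for some real
polynomials `A, B, C, D` (Laurent 2008, Theorem 3.23: `P_K = T(1 − x, 1 + x)`).
[cite: Laurent2008, Theorem 3.23] -/
theorem forall_eval_nonneg_Icc_iff' {a b : ℝ} (hab : a < b) (p : ℝ[X]) :
    (∀ x ∈ Set.Icc a b, 0 ≤ p.eval x) ↔
      ∃ A B C' D : ℝ[X], p = (X - C a) * (A ^ 2 + B ^ 2) + (C b - X) * (C' ^ 2 + D ^ 2) := by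
  constructor
  · intro h
    obtain ⟨A, B, C', D, -, hp⟩ :=
      markovLukacs_odd_two_sq hab p.natDegree p (by omega) h
    exact ⟨A, B, C', D, hp⟩
  · rintro ⟨A, B, C', D, hp⟩ x hx
    rw [hp]
    simp only [eval_add, eval_mul, eval_pow, eval_sub, eval_X, eval_C]
    have h1 : 0 ≤ x - a := by linarith [hx.1]
    have h2 : 0 ≤ b - x := by linarith [hx.2]
    positivity

end Literature.Algebra.Polynomial.MarkovLukacsTwoSquares

end
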